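import Summits.Schanuel.Schanuel.Theorems.RootDecomp1EGenericScale05
import Literature.NumberTheory.Transcendental.PeriodsWave0Proofs

/-!
# RootDecomp1EGenericScale — lens 2, generation 38 «GENERIC-SCALE INDUCTION STEP» (kernel: radical descent over an arbitrary type function; cells below the E-R19 floor) — continuation (RootDecomp1EGenericScale06): §6 members: density, `wG`, `zG`, `ιG`, `zG_eStable`, `zG_linearIndependent`, `exists_member`, `item31409_applied_at_zG`, `item31409_instance_at_zG`

(lens-2 g38 `GenericScale.lean` EDITION 2 [HOME/decomp-schanuel-lens-2/g38/GenericScale.lean EDITION 2 sha256 cf4f06e4…1307, 1762 l (ed.1 b58a0d29…; proof-only reshape `type_clash`, NOTE/EDITION2 L1842, writer re-check L1845) + GenericScaleCtrl ed.2 84ae4551… + NODE-g38.md ffd0a60c…; NODE L1822 / REQUEST L1823; critic ACK + OBJECTION L1800, VERDICT L1833]; port by census-1 gen 16 in six parts — see the PORT NOTE of part 01; `--supports stmt-Schanuel-31409`; rung 0.)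
-/

noncomputable section

open Complex

namespace Summit.Schanuel.Schanuel.Theorems.RootDecomp1EGenericScale

open MvPolynomial
open Summit.Schanuel.Schanuel.Theorems.RootDecomp1KHyper (mvlen mvlen_nonneg abs_coeff_le_mvlen one_le_mvlen
  exists_ball_eval_ne_zero)
open Summit.Schanuel.Schanuel.Theorems.RootDecomp1BRadicalDescent

variable {m : ℕ}

/-- `coordFamily` on the second block. -/
private theorem coordFamily_natAdd (w : Fin m → ℂ) (i : Fin m) :
    coordFamily w (Fin.natAdd m i) = cexp (w i) := by
  simp only [coordFamily, Function.comp_apply, finSumFinEquiv_symm_apply_natAdd, Sum.elim_inr]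

/-! ## §6 Members: the class is non-empty — generic scales are DENSE for every base tuple; the
E-stable members `zG ρ = (1, i, e, ie, ρ, iρ)` (n = 6) over the base `wG = (1, i, e, ie)` (m = 4). -/

section Members

/-- generic scales relative to ANY tuple are dense (Baire-free: explicit fast rationals, §2) -/
theorem dense_genericScale {N : ℕ} (v : Fin N → ℂ) : Dense {ρ : ℝ | GenericScale v ρ} :=
  dense_setOf_typeLiouville (relTypeFn_pos v)

/-- Generic scales are dense: one lies in every open interval. -/
theorem exists_genericScale_between {N : ℕ} (v : Fin N → ℂ) {a b : ℝ} (hab : a < b) :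
    ∃ ρ : ℝ, a < ρ ∧ ρ < b ∧ GenericScale v ρ :=
  dense_pos_typeLiouville (relTypeFn_pos v) hab

/-- the base quadruple `wG = (1, i, e, ie)` -/
def wG : Fin 4 → ℂ := ![1, I, ((Real.exp 1 : ℝ) : ℂ), I * ((Real.exp 1 : ℝ) : ℂ)]

/-- the members `zG ρ = (1, i, e, ie, ρ, iρ)` -/
def zG (ρ : ℝ) : Fin 6 → ℂ :=
  ![1, I, ((Real.exp 1 : ℝ) : ℂ), I * ((Real.exp 1 : ℝ) : ℂ), (ρ : ℂ), I * (ρ : ℂ)]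

/-- the first four coordinates -/
def ιG : Fin 4 ↪ Fin 6 := Fin.castLEEmb (by norm_num)

/-- `zG ρ ∘ ιG = wG`. -/
theorem zG_comp_ιG (ρ : ℝ) : zG ρ ∘ ιG = wG := by
  funext i
  fin_cases i <;> rfl

/-- `4 ∉ range ιG`. -/
theorem four_notMem_range_ιG : (4 : Fin 6) ∉ Set.range ιG := by
  rintro ⟨i, hi⟩
  have h : ∀ i : Fin 4, ιG i ≠ 4 := by decide
  exact h i hi

/-- `((Real.exp 1 : ℝ) : ℂ) = cexp 1`. -/
private theorem ofReal_exp_one : ((Real.exp 1 : ℝ) : ℂ) = cexp 1 := by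
  rw [Complex.ofReal_exp, Complex.ofReal_one]

/-- **membership**: `zG ρ ∈ InGenericScaleClass` for every generic scale `ρ > 0` relative to
`(wG, e^{wG})`; data `m = 4`, `ι = ιG`, `j = 4`, `i₀ = 0` (`w_{i₀} = 1`, `e^{w_{i₀}} = e`). -/
theorem inGenericScaleClass_zG {ρ : ℝ} (hρ0 : 0 < ρ) (hρ : GenericScale (coordFamily wG) ρ) :
    InGenericScaleClass (zG ρ) := by
  refine ⟨4, ιG, 4, 0, ρ, four_notMem_range_ιG, by norm_num, ?_, ?_, hρ0, ?_⟩
  · have h4 : zG ρ 4 = (ρ : ℂ) := rfl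
    have h0 : zG ρ (ιG 0) = 1 := rfl
    rw [h4, h0, mul_one]
  · have h0 : zG ρ (ιG 0) = 1 := rfl
    rw [h0]
    exact Literature.NumberTheory.Transcendental.transcendental_rat_cexp_one
  · rwa [zG_comp_ιG]

/-- `i` is algebraic. -/
private theorem isAlgebraic_I : IsAlgebraic ℚ I := by
  refine ⟨Polynomial.X ^ 2 + Polynomial.C 1, Polynomial.X_pow_add_C_ne_zero two_pos 1, ?_⟩
  simp [Complex.I_sq]

/-- `i` is not a rational number. -/
private theorem I_notMem_range_rat : I ∉ Set.range (algebraMap ℚ ℂ) := by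
  rintro ⟨q, hq⟩
  have := congrArg Complex.im hq
  simp at this

/-- **E-stability of the members** (`β = i`): `i · zG ρ ⊂ span_ℚ (zG ρ)`. -/
theorem zG_eStable (ρ : ℝ) : ∃ β : ℂ, IsAlgebraic ℚ β ∧ β ∉ Set.range (algebraMap ℚ ℂ) ∧
    ∀ i, β * zG ρ i ∈ Submodule.span ℚ (Set.range (zG ρ)) := by
  refine ⟨I, isAlgebraic_I, I_notMem_range_rat, fun i => ?_⟩
  have mem : ∀ j, zG ρ j ∈ Submodule.span ℚ (Set.range (zG ρ)) :=
    fun j => Submodule.subset_span ⟨j, rfl⟩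
  have e0 : zG ρ 0 = 1 := rfl
  have e1 : zG ρ 1 = I := rfl
  have e2 : zG ρ 2 = ((Real.exp 1 : ℝ) : ℂ) := rfl
  have e3 : zG ρ 3 = I * ((Real.exp 1 : ℝ) : ℂ) := rfl
  have e4 : zG ρ 4 = (ρ : ℂ) := rfl
  have e5 : zG ρ 5 = I * (ρ : ℂ) := rfl
  fin_cases i
  · show I * zG ρ 0 ∈ _
    rw [e0, mul_one, ← e1]; exact mem 1
  · show I * zG ρ 1 ∈ _
    have e : I * zG ρ 1 = (-1 : ℚ) • zG ρ 0 := by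
      rw [e1, e0, Rat.smul_def, Complex.I_mul_I]; push_cast; ring
    rw [e]; exact Submodule.smul_mem _ _ (mem 0)
  · show I * zG ρ 2 ∈ _
    rw [e2, ← e3]; exact mem 3
  · show I * zG ρ 3 ∈ _
    have e : I * zG ρ 3 = (-1 : ℚ) • zG ρ 2 := by
      rw [e3, e2, Rat.smul_def, ← mul_assoc, Complex.I_mul_I]; push_cast; ring
    rw [e]; exact Submodule.smul_mem _ _ (mem 2)
  · show I * zG ρ 4 ∈ _
    rw [e4, ← e5]; exact mem 5
  · show I * zG ρ 5 ∈ _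
    have e : I * zG ρ 5 = (-1 : ℚ) • zG ρ 4 := by
      rw [e5, e4, Rat.smul_def, ← mul_assoc, Complex.I_mul_I]; push_cast; ring
    rw [e]; exact Submodule.smul_mem _ _ (mem 4)

/-- the kernel at the member's base: `(e^ρ, ρ, e)` is algebraically independent for every generic scale
`ρ > 0` relative to `(wG, e^{wG})` (sub-family `θ = (e)`, `y₀ = 1`). -/
theorem algebraicIndependent_exp_rho_e {ρ : ℝ} (hρ0 : 0 < ρ) (hρ : GenericScale (coordFamily wG) ρ) :
    AlgebraicIndependent ℚ (Fin.cons (cexp ((ρ : ℂ) * 1))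
      (Fin.cons (ρ : ℂ) (coordFamily wG ∘ fun _ : Fin 1 => Fin.natAdd 4 0)) : Fin 3 → ℂ) := by
  have hf : Function.Injective (fun _ : Fin 1 => (Fin.natAdd 4 0 : Fin (4 + 4))) :=
    Function.injective_of_subsingleton _
  have hθ : AlgebraicIndependent ℚ (coordFamily wG ∘ fun _ : Fin 1 => Fin.natAdd 4 0) := by
    refine algebraicIndependent_unique_type_iff.mpr ?_
    show Transcendental ℚ (coordFamily wG (Fin.natAdd 4 0))
    rw [coordFamily_natAdd]
    exact Literature.NumberTheory.Transcendental.transcendental_rat_cexp_one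
  have hy : cexp 1 = coordFamily wG ((fun _ : Fin 1 => (Fin.natAdd 4 0 : Fin (4 + 4))) 0) := by
    rw [coordFamily_natAdd]; rfl
  exact algebraicIndependent_radical_generic (coordFamily wG) _ hf hθ 0 hy hρ hρ0

/-- `ρ ∉ ℚ + ℚ·e` for a generic scale `ρ` -/
theorem rho_notMem_ratSpan_e {ρ : ℝ} (hρ0 : 0 < ρ) (hρ : GenericScale (coordFamily wG) ρ) (a b : ℚ) :
    ρ ≠ a + b * Real.exp 1 := by
  intro hab
  have hai := algebraicIndependent_exp_rho_e hρ0 hρ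
  set x : Fin 3 → ℂ := (Fin.cons (cexp ((ρ : ℂ) * 1))
      (Fin.cons (ρ : ℂ) (coordFamily wG ∘ fun _ : Fin 1 => Fin.natAdd 4 0)) : Fin 3 → ℂ) with hx
  have hx1 : x 1 = (ρ : ℂ) := rfl
  have hx2 : x 2 = cexp 1 := by
    show (coordFamily wG ∘ fun _ : Fin 1 => (Fin.natAdd 4 0 : Fin (4 + 4))) 0 = cexp 1
    rw [Function.comp_apply, coordFamily_natAdd]; rfl
  have hT := hai.transcendental_adjoin (s := {0, 2}) (i := 1) (by decide)
  apply hT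
  have hmem : x 1 ∈ Algebra.adjoin ℚ (x '' {0, 2}) := by
    have h2 : x 2 ∈ Algebra.adjoin ℚ (x '' {0, 2}) := Algebra.subset_adjoin ⟨2, by simp, rfl⟩
    have : x 1 = algebraMap ℚ ℂ a + algebraMap ℚ ℂ b * x 2 := by
      rw [hx1, hx2, hab, ← ofReal_exp_one]; push_cast; simp
    rw [this]
    exact add_mem (Subalgebra.algebraMap_mem _ a) (mul_mem (Subalgebra.algebraMap_mem _ b) h2)
  exact isAlgebraic_algebraMap (⟨x 1, hmem⟩ : Algebra.adjoin ℚ (x '' {0, 2}))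

/-- `e ∉ ℚ` -/
theorem exp_one_ne_rat (q : ℚ) : Real.exp 1 ≠ q := by
  intro h
  apply Literature.NumberTheory.Transcendental.transcendental_rat_cexp_one
  have : cexp 1 = algebraMap ℚ ℂ q := by
    rw [← ofReal_exp_one, h]; push_cast; rfl
  rw [this]; exact isAlgebraic_algebraMap q

/-- no rational relation `a + b e + c ρ = 0` -/
theorem rat_rel_e_rho {ρ : ℝ} (hρ0 : 0 < ρ) (hρ : GenericScale (coordFamily wG) ρ) {a b c : ℚ}
    (h : (a : ℝ) + b * Real.exp 1 + c * ρ = 0) : a = 0 ∧ b = 0 ∧ c = 0 := by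
  by_cases hc : c = 0
  · subst hc
    by_cases hb : b = 0
    · subst hb
      simp at h
      exact ⟨by exact_mod_cast h, rfl, rfl⟩
    · exfalso
      refine exp_one_ne_rat (-a / b) ?_
      have hb' : (b : ℝ) ≠ 0 := by exact_mod_cast hb
      push_cast at h ⊢
      field_simp
      linarith
  · exfalso
    refine rho_notMem_ratSpan_e hρ0 hρ (-a / c) (-b / c) ?_
    have hc' : (c : ℝ) ≠ 0 := by exact_mod_cast hc
    push_cast
    field_simp
    linarith

/-- **the members are ℚ-linearly independent** -/
theorem zG_linearIndependent {ρ : ℝ} (hρ0 : 0 < ρ) (hρ : GenericScale (coordFamily wG) ρ) :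
    LinearIndependent ℚ (zG ρ) := by
  rw [Fintype.linearIndependent_iff]
  intro g hg
  rw [Fin.sum_univ_six] at hg
  simp only [Rat.smul_def] at hg
  have e0 : zG ρ 0 = 1 := rfl
  have e1 : zG ρ 1 = I := rfl
  have e2 : zG ρ 2 = ((Real.exp 1 : ℝ) : ℂ) := rfl
  have e3 : zG ρ 3 = I * ((Real.exp 1 : ℝ) : ℂ) := rfl
  have e4 : zG ρ 4 = (ρ : ℂ) := rfl
  have e5 : zG ρ 5 = I * (ρ : ℂ) := rfl
  rw [e0, e1, e2, e3, e4, e5] at hg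
  have hre1 : (cexp 1).re = Real.exp 1 := by rw [← Complex.ofReal_one, Complex.exp_ofReal_re]
  have him1 : (cexp 1).im = 0 := by rw [← Complex.ofReal_one, Complex.exp_ofReal_im]
  have hre : ((g 0 : ℚ) : ℝ) + (g 2 : ℚ) * Real.exp 1 + (g 4 : ℚ) * ρ = 0 := by
    have := congrArg Complex.re hg
    simpa [hre1, him1] using this
  have him : ((g 1 : ℚ) : ℝ) + (g 3 : ℚ) * Real.exp 1 + (g 5 : ℚ) * ρ = 0 := by
    have := congrArg Complex.im hg
    simpa [hre1, him1] using this
  obtain ⟨h0, h2, h4⟩ := rat_rel_e_rho hρ0 hρ hre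
  obtain ⟨h1, h3, h5⟩ := rat_rel_e_rho hρ0 hρ him
  intro i
  fin_cases i
  · exact h0
  · exact h1
  · exact h2
  · exact h3
  · exact h4
  · exact h5

/-- **NON-VACUITY with the EXACT scope hypotheses of the cell**: between any `0 ≤ a < b` there is a `ρ`
with `zG ρ` ℚ-linearly independent, in the class, and E-stable. -/
theorem exists_member {a b : ℝ} (ha : 0 ≤ a) (hab : a < b) :
    ∃ ρ : ℝ, a < ρ ∧ ρ < b ∧ LinearIndependent ℚ (zG ρ) ∧ InGenericScaleClass (zG ρ) ∧
      (∃ β : ℂ, IsAlgebraic ℚ β ∧ β ∉ Set.range (algebraMap ℚ ℂ) ∧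
        ∀ i, β * zG ρ i ∈ Submodule.span ℚ (Set.range (zG ρ))) := by
  obtain ⟨ρ, haρ, hρb, hρ⟩ := exists_genericScale_between (coordFamily wG) hab
  have hρ0 : 0 < ρ := lt_of_le_of_lt ha haρ
  exact ⟨ρ, haρ, hρb, zG_linearIndependent hρ0 hρ, inGenericScaleClass_zG hρ0 hρ, zG_eStable ρ⟩

/-- **Item 31409 `EStableDefectOne` APPLIED at a member** — the item's scope hypotheses hold at
`z := zG ρ`, `n := 6`; the first-failure binder is its `hIH`. -/
theorem item31409_applied_at_zG (h31409 : Summit.Schanuel.Schanuel.Theses.RootDecomp1E.EStableDefectOne)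
    {ρ : ℝ} (hρ0 : 0 < ρ) (hρ : GenericScale (coordFamily wG) ρ)
    (hIH : ∀ (m : ℕ) (w : Fin m → ℂ), m < 6 → LinearIndependent ℚ w →
        (∀ j, w j ∈ Submodule.span ℚ (Set.range (zG ρ))) →
        (m : Cardinal) ≤ Algebra.trdeg ℚ ↥(IntermediateField.adjoin ℚ
          (Set.range w ∪ Set.range (Complex.exp ∘ w))) + 1) :
    ((6 : ℕ) : Cardinal) ≤ Algebra.trdeg ℚ ↥(IntermediateField.adjoin ℚ
        (Set.range (zG ρ) ∪ Set.range (Complex.exp ∘ zG ρ))) + 1 :=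
  h31409 6 (zG ρ) (zG_linearIndependent hρ0 hρ) (zG_eStable ρ) hIH

/-- … and **the cell DISCHARGES the same instance, CONSUMING `hIH`** (at `(4, wG)`: the induction
hypothesis `4 ≤ trdeg ℚ(1, i, e, ie, e, eⁱ, eᵉ, e^{ie}) + 1`, i.e. `trdeg ℚ(e, eⁱ, eᵉ, e^{ie}) ≥ 3` —
an OPEN instance of `S⁻`). -/
theorem item31409_instance_at_zG {ρ : ℝ} (hρ0 : 0 < ρ) (hρ : GenericScale (coordFamily wG) ρ)
    (hIH : ∀ (m : ℕ) (w : Fin m → ℂ), m < 6 → LinearIndependent ℚ w →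
        (∀ j, w j ∈ Submodule.span ℚ (Set.range (zG ρ))) →
        (m : Cardinal) ≤ Algebra.trdeg ℚ ↥(IntermediateField.adjoin ℚ
          (Set.range w ∪ Set.range (Complex.exp ∘ w))) + 1) :
    ((6 : ℕ) : Cardinal) ≤ Algebra.trdeg ℚ ↥(IntermediateField.adjoin ℚ
        (Set.range (zG ρ) ∪ Set.range (Complex.exp ∘ zG ρ))) + 1 :=
  eStableDefectOne_genericScaleCell 6 (zG ρ) (zG_linearIndependent hρ0 hρ)
    (inGenericScaleClass_zG hρ0 hρ) (zG_eStable ρ) hIH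

end Members

end Summit.Schanuel.Schanuel.Theorems.RootDecomp1EGenericScale

end
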